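import Literature.Probability.Percolation.IsoradialRectangularLoops
import Literature.Probability.RandomPlanarGeometry.LoopConfigurations
import HarnessLib

/-!
# The typed loop representation of planar percolation and DKKMO's Theorems 1.2 / 1.7 as printed

Layer N1 (percolation side) of the decomposition of the named fact `dkkmo_rotation_invariance`
(`Literature.Probability.Percolation.LoopRotationInvariance`, **crit-perc.S25**). The tree states
crit-perc.S25 and the DKKMO universality facts (`dkkmo_universality_coupling`,
`dkkmo_linearDeformation_coupling`, `dkkmo_coupling`) in the conventions of the prelude's loop
space (based oriented loop classes, every dart a base point, hard centred window, Hausdorff and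
Lévy–Prokhorov edistances). This file states the two theorems of Duminil-Copin–Kozlowski–
Krachun–Manolescu–Oulamara, arXiv:2012.11672v2 (2026), that crit-perc.S25 rests on, **in the
paper's own conventions** (`LoopConfigurations`: typed configurations `F = F₀ ⊔ F₁` of unbased
loops compared by the unoriented distance `d` of eq. (1) inside the soft window `B(0, 1/ε)`, and
the coupling distance of eq. (2)), at `q = 1`:

* `dkkmo_theorem_1_2` — Theorem 1.2 (`d_CN` part): `d_CN(φ_{δℤ²}, φ_{e^{iα}δℤ²}) ≤ C δ^c` for all
  `α ∈ [0, 2π]`, `δ > 0`;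
* `dkkmo_theorem_1_7` — Theorem 1.7 (`d_CN` part, eq. (4)): `d_CN(φ_{δ𝕃(α)}, φ_{δ𝕃(π/2)}) < C δ^c`
  for all `α ∈ (0, π)`, `δ > 0`.

The `d_SS` (Schramm–Smirnov) halves of both theorems are not vendored (no quad-crossing space in
the prelude).

## The loop representation (DKKMO §1.2 p. 5, §2.3)

"`ω` can be seen as an element of `C` by considering the loop representation of the model [...]
on the medial graph, corresponding basically to the boundaries between the primal and dual
clusters. Then, we say that a loop is in `F₁` if it is the exterior boundary of a primal cluster,
and in `F₀` if it is the exterior boundary of a dual cluster."  The combinatorial loops are the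
interface loops `IsInterfaceLoop ω γ` of crit-perc.S25 (cyclic dart lists on the medial lattice of
`ℤ²` obeying the cluster-boundary turning rule, open primal edges on the left — Camia–Newman's
orientation convention, CMP 268 (2006), §4: "the hexagon to the right of the edge [...] is blue",
here: the primal cluster to the left), drawn as closed polylines through the edge midpoints of
`δ e^{iα} ℤ²` (`loopCurve`) or of `δ 𝕃(α)` (`isoRectLoopCurve`) and taken as *unbased* loops
(`UnbasedLoop.mk`, which forgets the base point = starting dart).

**Typing.** An interface loop separates the primal cluster on its left from the dual cluster on
its right, and exactly one of the two lies on its bounded side: the loop is the exterior boundary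
of the primal cluster on its left iff that side is the bounded one iff the loop is traversed
counterclockwise, and otherwise it is the exterior boundary of the dual cluster on its right
(traversed clockwise around it). We therefore type a loop by its orientation, computed
combinatorially as the sign of the shoelace (signed area) sum of its medial polygon on `ℤ²`
(`loopSignedArea`, `loopType`); the type does not depend on the base point (`loopType_rotate`) and
is the same on every lattice `δ e^{iα} ℤ²`, `δ 𝕃(α)` (rotations and the maps `isoRectLinear α`,
`α ∈ (0, π)`, of determinant `2 sin α > 0`, preserve orientation).

## References

* H. Duminil-Copin, K. K. Kozlowski, D. Krachun, I. Manolescu, M. Oulamara, arXiv:2012.11672v2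
  (2026): §1.2 (space `C`, `d_CN`, eq. (1)–(2), loop representation and typing, p. 5), Theorem 1.2,
  §1.4 and Theorem 1.7 (eq. (4)), §2.3 (loop model on the medial graph).
* F. Camia, C. M. Newman, Comm. Math. Phys. 268 (2006), §4 (oriented cluster boundaries).
* G. Grimmett, *Percolation*, 2nd ed. (1999), §11.2 (medial lattice, interfaces of `ℤ²`).
-/

noncomputable section

open MeasureTheory Set Complex
open scoped ENNReal Real

namespace Literature.Probability.Percolation

open LatticeModels

/-! ### Orientation type of an interface loop -/

/-- Twice the signed area enclosed by the closed polygon through the points of `l` (shoelace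
formula `Σ (xᵢ yᵢ₊₁ − xᵢ₊₁ yᵢ)`, indices cyclic): positive for counterclockwise simple polygons,
negative for clockwise ones. [folklore] -/
def shoelace (l : List ℂ) : ℝ :=
  ((l.zip (l.rotate 1)).map fun p ↦ p.1.re * p.2.im - p.2.re * p.1.im).sum

/-- The shoelace sum is invariant under cyclic rotation of the vertex list (change of base
point). [folklore] -/
theorem shoelace_rotate (l : List ℂ) (k : ℕ) : shoelace (l.rotate k) = shoelace l := by
  unfold shoelace
  have hzip : (l.rotate k).zip ((l.rotate k).rotate 1) = (l.zip (l.rotate 1)).rotate k := by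
    apply List.ext_getElem
    · simp
    · intro i h1 h2
      rcases Nat.eq_zero_or_pos l.length with h0 | hn
      · simp [List.length_eq_zero_iff.1 h0] at h1
      have hlen : (l.zip (l.rotate 1)).length = l.length := by simp
      simp only [List.getElem_rotate, List.getElem_zip, List.rotate_rotate, Prod.mk.injEq, hlen]
      refine ⟨trivial, ?_⟩
      congr 1
      rw [Nat.mod_add_mod]
      ac_rfl
  rw [hzip, List.map_rotate]
  exact (List.rotate_perm _ k).sum_eq

/-- Twice the signed area of the medial polygon of the dart list `γ` on `ℤ²` (mesh `1`): the
shoelace sum of the edge midpoints `medialPoint 1 e`, `e ∈ γ`. Positive iff the closed medial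
circuit `γ` is traversed counterclockwise. [folklore] -/
def loopSignedArea (γ : List MedialVertex) : ℝ := shoelace (γ.map (medialPoint 1))

/-- The signed area does not depend on the base point. [folklore] -/
theorem loopSignedArea_rotate (γ : List MedialVertex) (k : ℕ) :
    loopSignedArea (γ.rotate k) = loopSignedArea γ := by
  rw [loopSignedArea, List.map_rotate, shoelace_rotate, loopSignedArea]

/-- **The type `i ∈ {0, 1}` of an interface loop** (DKKMO, arXiv:2012.11672v2, §1.2, p. 5: "a
loop is in `F₁` if it is the exterior boundary of a primal cluster, and in `F₀` if it is the
exterior boundary of a dual cluster"). For the cluster-interface loops of `IsInterfaceLoop` (open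
primal edges on the left) the loop is the exterior boundary of the primal cluster on its left iff
it is traversed counterclockwise (positive signed area), and otherwise it is the exterior boundary
of the dual cluster on its right: type `1` iff `loopSignedArea γ > 0`. [cite: arXiv201211672v2, §1.2] -/
def loopType (γ : List MedialVertex) : Fin 2 := if 0 < loopSignedArea γ then 1 else 0

/-- The type does not depend on the base point. [folklore] -/
theorem loopType_rotate (γ : List MedialVertex) (k : ℕ) : loopType (γ.rotate k) = loopType γ := by
  rw [loopType, loopSignedArea_rotate, loopType]

/-! ### The typed loop configurations of a bond configuration -/

/-- **The loop representation of `ω` on the rotated square lattice `δ e^{iα} ℤ²`** as a point of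
DKKMO's space `C` (arXiv:2012.11672v2, §1.2 p. 5, §2.3): `F i` is the set of unbased loops
`loopCurve δ α γ` of the interface loops `γ` of `ω` (`IsInterfaceLoop ω γ`) of type `i`
(`loopType`: `F 1` = exterior boundaries of primal clusters, `F 0` = of dual clusters). Full-plane
configuration, no window (the window `B(0, 1/ε)` enters through `d_CN`). [cite: arXiv201211672v2, §1.2] -/
def bondLoopConfig (δ α : ℝ) (ω : BondConfig (Site 2)) : RandomPlanarGeometry.LoopConfig ℂ where
  F i := {u | ∃ (γ : List MedialVertex) (h : IsInterfaceLoop ω γ), loopType γ = i ∧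
    u = RandomPlanarGeometry.UnbasedLoop.mk (RandomPlanarGeometry.BasedLoop.mk (loopCurve δ α γ) (isLoop_loopCurve δ α h.ne_nil))}

/-- **The loop representation of `ω` on the isoradial rectangular lattice `δ 𝕃(α)`** as a point
of DKKMO's space `C` (arXiv:2012.11672v2, §1.2, §1.4, §2.3): as `bondLoopConfig`, with the loops
drawn through the `𝕃(α)`-midpoints (`isoRectLoopCurve δ α γ`); same combinatorial loops and
types (the embedding `isoRectLinear α`, `α ∈ (0, π)`, preserves orientation). [cite: arXiv201211672v2, §1.4] -/
def isoRectLoopConfig (δ α : ℝ) (ω : BondConfig (Site 2)) : RandomPlanarGeometry.LoopConfig ℂ where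
  F i := {u | ∃ (γ : List MedialVertex) (h : IsInterfaceLoop ω γ), loopType γ = i ∧
    u = RandomPlanarGeometry.UnbasedLoop.mk (RandomPlanarGeometry.BasedLoop.mk (isoRectLoopCurve δ α γ) (isLoop_isoRectLoopCurve δ α h.ne_nil))}

/-- Membership in the loop representation on `δ e^{iα} ℤ²`, unfolded. [folklore] -/
theorem mem_bondLoopConfig_iff {δ α : ℝ} {ω : BondConfig (Site 2)} {i : Fin 2} {u : RandomPlanarGeometry.UnbasedLoop ℂ} :
    u ∈ (bondLoopConfig δ α ω).F i ↔ ∃ (γ : List MedialVertex) (h : IsInterfaceLoop ω γ),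
      loopType γ = i ∧
        u = RandomPlanarGeometry.UnbasedLoop.mk (RandomPlanarGeometry.BasedLoop.mk (loopCurve δ α γ) (isLoop_loopCurve δ α h.ne_nil)) :=
  Iff.rfl

/-- Membership in the loop representation on `δ 𝕃(α)`, unfolded. [folklore] -/
theorem mem_isoRectLoopConfig_iff {δ α : ℝ} {ω : BondConfig (Site 2)} {i : Fin 2}
    {u : RandomPlanarGeometry.UnbasedLoop ℂ} :
    u ∈ (isoRectLoopConfig δ α ω).F i ↔ ∃ (γ : List MedialVertex) (h : IsInterfaceLoop ω γ),
      loopType γ = i ∧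
        u = RandomPlanarGeometry.UnbasedLoop.mk (RandomPlanarGeometry.BasedLoop.mk (isoRectLoopCurve δ α γ)
          (isLoop_isoRectLoopCurve δ α h.ne_nil)) :=
  Iff.rfl

/-- At `α = π/2` the loop representation on `δ 𝕃(π/2)` is the loop representation on the square
lattice of mesh `√2 δ` rotated by `π/4` ("`φ_{𝕃(π/2)}` is the critical random-cluster measure on
`ℤ²` rotated by `π/4` and dilated by `√2`", DKKMO §1.4). [cite: arXiv201211672v2, §1.4] -/
theorem isoRectLoopConfig_pi_div_two (δ : ℝ) (ω : BondConfig (Site 2)) :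
    isoRectLoopConfig δ (π / 2) ω = bondLoopConfig (Real.sqrt 2 * δ) (π / 4) ω := by
  ext i u
  simp only [mem_isoRectLoopConfig_iff, mem_bondLoopConfig_iff, isoRectLoopCurve_pi_div_two]

/-! ### DKKMO's Theorems 1.2 and 1.7 at `q = 1`, as printed (named facts) -/

/-- **DKKMO Theorem 1.2 at `q = 1`, `d_CN` part, as printed** (Duminil-Copin–Kozlowski–Krachun–
Manolescu–Oulamara, arXiv:2012.11672v2 (2026), Theorem 1.2: "Fix `q ∈ [1, 4]`. There exist
constants `c, C > 0` such that the following holds. For an angle `α ∈ [0, 2π]` write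
`φ_{e^{iα}δℤ²}` for the critical random-cluster measure on the rescaled lattice `δℤ²`, rotated by
`α`. Then, for any `α ∈ [0, 2π]` and `δ > 0`, `d_CN(φ_{δℤ²}, φ_{e^{iα}δℤ²}) ≤ C δ^c`.")
Here `q = 1`: `φ` is critical bond percolation `bondPercolation (zdGraph 2) half`, read on `δℤ²`
through the loop representation `bondLoopConfig δ 0` and on `e^{iα}δℤ²` through
`bondLoopConfig δ α`; `d_CN` on laws is the coupling distance `LoopConfig.cnLawEDist` of eq. (2)
(couplings realised on pairs of configurations) built on the printed `d_CN` of §1.2 / eq. (1)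
(typed, unbased, unoriented loops; soft window `B(0, 1/ε)`). The `d_SS` half of the theorem is
not vendored. The tree's crit-perc.S25 (`dkkmo_rotation_invariance`) is the same theorem in the
prelude's conventions. [cite: arXiv201211672v2, Thm 1.2] -/
def dkkmo_theorem_1_2 : Prop :=
  ∃ c C : ℝ, 0 < c ∧ 0 < C ∧ ∀ α ∈ Set.Icc (0 : ℝ) (2 * π), ∀ δ : ℝ, 0 < δ →
    RandomPlanarGeometry.LoopConfig.cnLawEDist (bondPercolation (zdGraph 2) half) (bondLoopConfig δ 0)
        (bondPercolation (zdGraph 2) half) (bondLoopConfig δ α) ≤ ENNReal.ofReal (C * δ ^ c)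

/-- **DKKMO Theorem 1.7 at `q = 1`, `d_CN` part, as printed** (arXiv:2012.11672v2 (2026),
Theorem 1.7, eq. (4): "Fix `q ∈ [1, 4]`. There exist constants `c, C > 0` such that, for every
`α ∈ (0, π)` and `δ > 0`, `d_CN(φ_{δ𝕃(α)}, φ_{δ𝕃(π/2)}) < C δ^c`.") Here `q = 1`: `φ_{𝕃(α)}` is
the product measure `isoRectPercolation α` with DKKMO's isoradial weights (§1.4), read on `δ 𝕃(α)`
through the loop representation `isoRectLoopConfig δ α`; `d_CN` on laws is
`LoopConfig.cnLawEDist` (eq. (2)) over the printed `d_CN` (§1.2, eq. (1)). The `d_SS` half is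
not vendored. The tree's `dkkmo_universality_coupling` is the same theorem in the prelude's
conventions. [cite: arXiv201211672v2, Thm 1.7] -/
def dkkmo_theorem_1_7 : Prop :=
  ∃ c C : ℝ, 0 < c ∧ 0 < C ∧ ∀ α ∈ Set.Ioo (0 : ℝ) π, ∀ δ : ℝ, 0 < δ →
    RandomPlanarGeometry.LoopConfig.cnLawEDist (isoRectPercolation α) (isoRectLoopConfig δ α)
        (isoRectPercolation (π / 2)) (isoRectLoopConfig δ (π / 2)) < ENNReal.ofReal (C * δ ^ c)

/-- The printed bound of Theorem 1.7 in coupling form: for every `α ∈ (0, π)` and `δ > 0` there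
is a coupling `P` of `φ_{𝕃(α)}` and `φ_{𝕃(π/2)}` under which the two loop representations fail to
be `C δ^c`-close (printed relation `d_CN ≤ C δ^c`) with probability `< C δ^c`
(`LoopConfig.exists_coupling_of_cnLawEDist_lt`). [cite: arXiv201211672v2, Thm 1.7, eq. (2)] -/
theorem dkkmo_theorem_1_7.exists_coupling (h : dkkmo_theorem_1_7) :
    ∃ c C : ℝ, 0 < c ∧ 0 < C ∧ ∀ α ∈ Set.Ioo (0 : ℝ) π, ∀ δ : ℝ, 0 < δ →
      ∃ P : Measure (BondConfig (Site 2) × BondConfig (Site 2)),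
        P.map Prod.fst = isoRectPercolation α ∧ P.map Prod.snd = isoRectPercolation (π / 2) ∧
        P {p | ¬ RandomPlanarGeometry.LoopConfig.IsClose (C * δ ^ c) (isoRectLoopConfig δ α p.1)
            (isoRectLoopConfig δ (π / 2) p.2)} < ENNReal.ofReal (C * δ ^ c) := by
  obtain ⟨c, C, hc, hC, h⟩ := h
  exact ⟨c, C, hc, hC, fun α hα δ hδ ↦ RandomPlanarGeometry.LoopConfig.exists_coupling_of_cnLawEDist_lt (h α hα δ hδ)⟩

/-- The printed bound of Theorem 1.2 in coupling form: for every `α ∈ [0, 2π]`, `δ > 0` and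
`ε > C δ^c` there is a coupling of `φ_{δℤ²}` and `φ_{e^{iα}δℤ²}` under which the two loop
representations fail to be `ε`-close with probability `< ε`
(`LoopConfig.cnLawEDist_le_iff_forall_lt`). [cite: arXiv201211672v2, Thm 1.2, eq. (2)] -/
theorem dkkmo_theorem_1_2.exists_coupling (h : dkkmo_theorem_1_2) :
    ∃ c C : ℝ, 0 < c ∧ 0 < C ∧ ∀ α ∈ Set.Icc (0 : ℝ) (2 * π), ∀ δ : ℝ, 0 < δ → ∀ ε : ℝ,
      C * δ ^ c < ε →
      ∃ P : Measure (BondConfig (Site 2) × BondConfig (Site 2)),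
        P.map Prod.fst = bondPercolation (zdGraph 2) half ∧
        P.map Prod.snd = bondPercolation (zdGraph 2) half ∧
        P {p | ¬ RandomPlanarGeometry.LoopConfig.IsClose ε (bondLoopConfig δ 0 p.1) (bondLoopConfig δ α p.2)} <
          ENNReal.ofReal ε := by
  obtain ⟨c, C, hc, hC, h⟩ := h
  refine ⟨c, C, hc, hC, fun α hα δ hδ ↦ ?_⟩
  exact (RandomPlanarGeometry.LoopConfig.cnLawEDist_le_iff_forall_lt (by positivity)).1 (h α hα δ hδ)

end Literature.Probability.Percolation

end
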